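import Literature.Probability.LatticeModels.RegularisedCoulombForm
import HarnessLib

/-!
# The full Laplacian `DDᵀ + EᵀE` of a flux complex `T → D → E` and the Coulomb form on fluxes

Support file for the Coulomb-gas (monopole) representation of four-dimensional `U(1)` lattice gauge
theory with the Villain action (proof programme of the named fact
`Literature.MathematicalPhysics.QuantumFieldTheory.FrohlichSpencerU1PerimeterLawD4` and of its
corollary `Literature.Barriers.QuantumFields.AbelianDeconfinementD4`). Generic finite-dimensional
linear algebra of a "complex" of real matrices `T : ℝ^ι → ℝ^P`, `D : ℝ^P → ℝ^κ`, `E : ℝ^κ → ℝ^φ`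
(free link angles → plaquette fields → cube fields → 4-cell fields of a box) which is exact at `P`
and at `κ` (`ker D = range T`, `ker E = range D`): then the full Laplacian `B' = DDᵀ + EᵀE` on
`ℝ^κ` (`-Δ = dδ + δd` in degree three) is INVERTIBLE, and on fluxes its inverse is the Coulomb
kernel of the dual model exactly — Fröhlich–Spencer (2.35): `(μ, V_Λ μ) = (μ, (-Δ_Λ)⁻¹ μ)` for
`δμ = 0` — so that no infrared regulator is needed:

* `lap D E = DDᵀ + EᵀE`, `dotProduct_lap_mulVec` (`⟨x,B'x⟩ = ‖Dᵀx‖² + ‖Ex‖²`), `posDef_lap`;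
* `transpose_mulVec_inv_lap_flux` (**`Dᵀ B'⁻¹ D m = m_⊥`**, `m_⊥ = perpPart T m`),
  `flux_dotProduct_inv_lap_flux` (`⟨Dm, B'⁻¹Dm'⟩ = ⟨m_⊥, m'⟩`), `flux_dotProduct_inv_lap_flux_self`
  (`= ‖m_⊥‖²`).

Hypotheses are passed in `mulVec` form (`E (D v) = 0`, …) so that the file can be instantiated from
files with heavy imports. Everything is proved; no named fact is introduced.

## References

* J. Fröhlich, T. Spencer, Comm. Math. Phys. 83 (1982) 411–454, §2.5 (2.35), §2.7 (2.51)–(2.54).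
  [FrohlichSpencerCMP1982]
-/

noncomputable section

open Matrix Finset

namespace Literature.Probability.LatticeModels

namespace GaussianCoord

variable {ι κ P φ : Type*} [Fintype ι] [Fintype κ] [Fintype P] [Fintype φ]
  [DecidableEq ι] [DecidableEq κ]

/-- **The full Laplacian** `B' = DDᵀ + EᵀE` on `ℝ^κ`. [cite: FrohlichSpencerCMP1982, §2.5 (2.35)] -/
def lap (D : Matrix κ P ℝ) (E : Matrix φ κ ℝ) : Matrix κ κ ℝ := D * Dᵀ + Eᵀ * E

omit [DecidableEq κ] in
/-- `B' x = D(Dᵀx) + Eᵀ(Ex)`. [folklore] -/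
theorem lap_mulVec (D : Matrix κ P ℝ) (E : Matrix φ κ ℝ) (x : κ → ℝ) :
    lap D E *ᵥ x = D *ᵥ (Dᵀ *ᵥ x) + Eᵀ *ᵥ (E *ᵥ x) := by
  rw [lap, Matrix.add_mulVec, Matrix.mulVec_mulVec, Matrix.mulVec_mulVec]

omit [DecidableEq κ] in
/-- `⟨x, B'x⟩ = ‖Dᵀx‖² + ‖Ex‖²`. [folklore] -/
theorem dotProduct_lap_mulVec (D : Matrix κ P ℝ) (E : Matrix φ κ ℝ) (x : κ → ℝ) :
    x ⬝ᵥ (lap D E *ᵥ x) = (Dᵀ *ᵥ x) ⬝ᵥ (Dᵀ *ᵥ x) + (E *ᵥ x) ⬝ᵥ (E *ᵥ x) := by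
  rw [lap_mulVec, dotProduct_add, dotProduct_mulVec x D, ← Matrix.mulVec_transpose, dotProduct_mulVec x Eᵀ,
    ← Matrix.mulVec_transpose, Matrix.transpose_transpose]

omit [DecidableEq κ] [Fintype κ] in
/-- `B'` is symmetric. [folklore] -/
theorem transpose_lap (D : Matrix κ P ℝ) (E : Matrix φ κ ℝ) : (lap D E)ᵀ = lap D E := by
  rw [lap, Matrix.transpose_add, Matrix.transpose_mul, Matrix.transpose_mul, Matrix.transpose_transpose,
    Matrix.transpose_transpose]

omit [DecidableEq κ] in
/-- **The full Laplacian is positive definite** when `ker E ⊆ range D`: `B'x = 0 ⇒ Ex = 0 ⇒ x = Dm ⇒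
‖x‖² = ⟨Dᵀx, m⟩ = 0`. [cite: FrohlichSpencerCMP1982, §2.5 (2.35)] -/
theorem posDef_lap (D : Matrix κ P ℝ) (E : Matrix φ κ ℝ) (hexact : ∀ q : κ → ℝ, E *ᵥ q = 0 → ∃ m, D *ᵥ m = q) :
    (lap D E).PosDef := by
  refine PosDef.of_dotProduct_mulVec_pos ?_ fun x hx => ?_
  · rw [Matrix.IsHermitian, Matrix.conjTranspose_eq_transpose_of_trivial, transpose_lap]
  · simp only [star_trivial]
    rw [dotProduct_lap_mulVec]
    have h1 : 0 ≤ (Dᵀ *ᵥ x) ⬝ᵥ (Dᵀ *ᵥ x) := Finset.sum_nonneg fun i _ => mul_self_nonneg _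
    have h2 : 0 ≤ (E *ᵥ x) ⬝ᵥ (E *ᵥ x) := Finset.sum_nonneg fun i _ => mul_self_nonneg _
    rcases (add_nonneg h1 h2).lt_or_eq with h | h
    · exact h
    · exfalso
      have hD : Dᵀ *ᵥ x = 0 := dotProduct_self_eq_zero.1 (by linarith)
      have hE : E *ᵥ x = 0 := dotProduct_self_eq_zero.1 (by linarith)
      obtain ⟨m, hm⟩ := hexact x hE
      have : x ⬝ᵥ x = 0 := by
        calc x ⬝ᵥ x = (D *ᵥ m) ⬝ᵥ x := by rw [hm]
          _ = m ⬝ᵥ (Dᵀ *ᵥ x) := mulVec_dotProduct_eq _ _ _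
          _ = 0 := by rw [hD, dotProduct_zero]
      exact hx (dotProduct_self_eq_zero.1 this)

/-- **The key identity on fluxes**: `Dᵀ B'⁻¹ D m = m_⊥ = perpPart T m` for the complex
`T → D → E` (`ker D = range T`, `E D = 0`, `ker E ⊆ range D`): `x = B'⁻¹Dm` has `EᵀEx = 0` and
`DDᵀx = Dm`; `Dᵀx` and `m_⊥` both lie in `{Tᵀ· = 0}` and have the same image under `DᵀD`, and
`{Tᵀ· = 0} ∩ ker DᵀD = {Tᵀ· = 0} ∩ range T = 0`. [cite: FrohlichSpencerCMP1982, §2.5 (2.35), §2.7 (2.51)–(2.52)] -/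
theorem transpose_mulVec_inv_lap_flux (T : Matrix P ι ℝ) (D : Matrix κ P ℝ) (E : Matrix φ κ ℝ)
    (hM : (gram T).PosDef) (hker : KerEqRange T D) (hED : ∀ v : P → ℝ, E *ᵥ (D *ᵥ v) = 0)
    (hexact : ∀ q : κ → ℝ, E *ᵥ q = 0 → ∃ m, D *ᵥ m = q) (m : P → ℝ) :
    Dᵀ *ᵥ ((lap D E)⁻¹ *ᵥ (D *ᵥ m)) = perpPart T m := by
  have hdet : IsUnit (lap D E).det := (Matrix.isUnit_iff_isUnit_det _).1 (posDef_lap D E hexact).isUnit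
  set x := (lap D E)⁻¹ *ᵥ (D *ᵥ m) with hx
  have hBx : lap D E *ᵥ x = D *ᵥ m := by
    rw [hx, Matrix.mulVec_mulVec, Matrix.mul_nonsing_inv _ hdet, Matrix.one_mulVec]
  -- `Eᵀ(Ex) = 0`
  have hEE : Eᵀ *ᵥ (E *ᵥ x) = 0 := by
    have hE : E *ᵥ (lap D E *ᵥ x) = 0 := by rw [hBx]; exact hED m
    rw [lap_mulVec, Matrix.mulVec_add, hED, zero_add] at hE
    have : (Eᵀ *ᵥ (E *ᵥ x)) ⬝ᵥ (Eᵀ *ᵥ (E *ᵥ x)) = 0 := by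
      conv_lhs => rw [mulVec_dotProduct_eq, Matrix.transpose_transpose, hE]
      exact dotProduct_zero _
    exact dotProduct_self_eq_zero.1 this
  have hDDx : D *ᵥ (Dᵀ *ᵥ x) = D *ᵥ m := by
    have := hBx
    rwa [lap_mulVec, hEE, add_zero] at this
  -- `y = Dᵀx` and `p = m_⊥`: both in `W`, same image under `DᵀD`
  set y := Dᵀ *ᵥ x with hy
  have hyW : Tᵀ *ᵥ y = 0 := by
    have h0 : ∀ θ : ι → ℝ, θ ⬝ᵥ (Tᵀ *ᵥ y) = 0 := fun θ => by
      rw [← mulVec_dotProduct_eq, hy, ← mulVec_dotProduct_eq, Matrix.mulVec_mulVec, hker.mul_eq_zero,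
        Matrix.zero_mulVec, zero_dotProduct]
    exact dotProduct_self_eq_zero.1 (h0 _)
  have hGy : Dᵀ *ᵥ (D *ᵥ y) = Dᵀ *ᵥ (D *ᵥ m) := by rw [hy, hDDx]
  set p := perpPart T m with hp
  have hpW : Tᵀ *ᵥ p = 0 := transpose_mulVec_perpPart _ hM m
  have hGp : Dᵀ *ᵥ (D *ᵥ p) = Dᵀ *ᵥ (D *ᵥ m) := by
    have hm : m = exactPart T m + p := by rw [hp, perpPart]; abel
    conv_rhs => rw [hm]
    rw [Matrix.mulVec_add, mulVec_exactPart_eq_zero hker, zero_add]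
  have hD0 : D *ᵥ (y - p) = 0 := by
    have hG0 : Dᵀ *ᵥ (D *ᵥ (y - p)) = 0 := by rw [Matrix.mulVec_sub, Matrix.mulVec_sub, hGy, hGp, sub_self]
    have : (D *ᵥ (y - p)) ⬝ᵥ (D *ᵥ (y - p)) = 0 := by
      rw [mulVec_dotProduct_eq, hG0, dotProduct_zero]
    exact dotProduct_self_eq_zero.1 this
  obtain ⟨θ, hθ⟩ := hker.exact_of_closed _ hD0
  have hzero : y - p = 0 := by
    have : (y - p) ⬝ᵥ (y - p) = 0 := by
      calc (y - p) ⬝ᵥ (y - p) = (T *ᵥ θ) ⬝ᵥ (y - p) := by rw [hθ]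
        _ = θ ⬝ᵥ (Tᵀ *ᵥ (y - p)) := mulVec_dotProduct_eq _ _ _
        _ = 0 := by rw [Matrix.mulVec_sub, hyW, hpW, sub_zero, dotProduct_zero]
    exact dotProduct_self_eq_zero.1 this
  exact sub_eq_zero.1 hzero

/-- **The Coulomb form on fluxes**: `⟨Dm, B'⁻¹ Dm'⟩ = ⟨m'_⊥, m⟩`. [cite: FrohlichSpencerCMP1982, §2.5 (2.35), §2.7 (2.52)–(2.54)] -/
theorem flux_dotProduct_inv_lap_flux (T : Matrix P ι ℝ) (D : Matrix κ P ℝ) (E : Matrix φ κ ℝ)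
    (hM : (gram T).PosDef) (hker : KerEqRange T D) (hED : ∀ v : P → ℝ, E *ᵥ (D *ᵥ v) = 0)
    (hexact : ∀ q : κ → ℝ, E *ᵥ q = 0 → ∃ m, D *ᵥ m = q) (m m' : P → ℝ) :
    (D *ᵥ m) ⬝ᵥ ((lap D E)⁻¹ *ᵥ (D *ᵥ m')) = perpPart T m' ⬝ᵥ m := by
  rw [mulVec_dotProduct_eq, transpose_mulVec_inv_lap_flux T D E hM hker hED hexact, dotProduct_comm]

/-- `⟨Dm, B'⁻¹Dm⟩ = ‖m_⊥‖²`. [cite: FrohlichSpencerCMP1982, §2.5 (2.35)] -/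
theorem flux_dotProduct_inv_lap_flux_self (T : Matrix P ι ℝ) (D : Matrix κ P ℝ) (E : Matrix φ κ ℝ)
    (hM : (gram T).PosDef) (hker : KerEqRange T D) (hED : ∀ v : P → ℝ, E *ᵥ (D *ᵥ v) = 0)
    (hexact : ∀ q : κ → ℝ, E *ᵥ q = 0 → ∃ m, D *ᵥ m = q) (m : P → ℝ) :
    (D *ᵥ m) ⬝ᵥ ((lap D E)⁻¹ *ᵥ (D *ᵥ m)) = perpPart T m ⬝ᵥ perpPart T m := by
  rw [flux_dotProduct_inv_lap_flux T D E hM hker hED hexact, dotProduct_comm]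
  -- `⟨m, m_⊥⟩ = ⟨m_⊥, m_⊥⟩`
  have hm : exactPart T m + perpPart T m = m := by rw [perpPart]; abel
  rw [← congrArg (· ⬝ᵥ perpPart T m) hm, add_dotProduct, exactPart_dotProduct_perpPart hM, zero_add]

end GaussianCoord

end Literature.Probability.LatticeModels
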